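import Mathlib.Analysis.SpecialFunctions.Integrals.Basic
import HarnessLib

/-!
# RiemannHypothesis / DBN — RH-FREE kernel objects of the dynamic de Bruijn–Newman certificate

Route `RiemannHypothesis/DBN` (de Bruijn–Newman heat flow).  This `Defs` file fixes, for the
record of the RH ladder's column DBN (human ruling D-0040; cell `pub-dbn`, theory memos
THEORY-R1/R2/R3 of 2026-08-25), the two kernels of the 2001 dynamic Λ-certificate's descent lemma
and the RH-FREE statements about them that the prover seat files as theorems
(`Theorems/DBNKernelMasses.lean` — T1b/T1c/N1; `Theorems/DBNKernelHolomorphy.lean` +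
`Theorems/DBNBoundaryReduction.lean` — T1a-ε/T1a; `Theorems/DBNClassFloor.lean` — T3s/T3).  Everything here is
pure real analysis: no `ζ`, no `H_t`, no zeros-to-height input; nothing in this file bears on the
truth of RH.

Normalisation (THEORY-R1 §1): top zero of `H_t` at `(0, Y)`; another zero pair at
`(ξY, ±ηY)`, `0 ≤ η ≤ 1` (envelope); probe (smeared zero detector) at height `cY` (`c > 1`),
biweight half-width `κY` (`κ ≥ 0`), horizontal offset `uY`.

* `biweight`        — the bump `φ(v) = (15/16)(1-v²)²` on `[-1,1]`;
* `descentKernel`   — `P(ξ,η) = 2[(1-η)/(ξ²+(1-η)²) + (1+η)/(ξ²+(1+η)²)]`, `Y` times the downward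
                      velocity the pair imparts to the top zero (Csordas–Smith–Varga dynamics);
* `probeKernel`     — `S_{c,κ,u}(ξ,η) = ∫_{-1}^{1} φ(v)[(c-η)/((c-η)²+(ξ-u-κv)²) + (c+η)/((c+η)²+(ξ-u-κv)²)] dv`;
* `signedKernel`    — `k = Σᵢ wᵢ S_{cᵢ,κᵢ,uᵢ}` (weights of either sign);
* `Admissible2D`    — hypothesis (K) of the descent lemma: `k ≤ P` on `ℝ × [0,1] ∖ {(0,1)}`;
* `Admissible1D`    — the boundary inequality `k(ξ,1) ≤ 4/(ξ²+4)`;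
* `descentKernelEps`— `P` with its poles moved from `(0,±1)` to `(0,±(1+ε))` (THEORY-R3 §6);
* `classFloor`, `classPotential` — the idealised class floor `(4/ℓ)(Y₀ - (4/ℓ) log(1+ℓY₀/4))`.

Typed targets (Props; THEORY-R1 §2 = T1, THEORY-R2 §5 = T3, THEORY-R3 §6 = T1a-ε, THEORY-R1 §3 = N1),
verbatim from the theory seat's sketches `pub-dbn-theory/Sketch.lean` (gen 0),
`Sketch2.lean` (sha16 b3a04c43a0b342a5), `Sketch3.lean` (sha16 4221bacfb0657169):
`BoundaryReduction` (T1a), `ProbeMass` (T1b), `DescentMass`, `NetWeightCeiling` (T1c),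
`DoubleRowInvisibility` (N1), `ClassPotentialDeriv` (T3s), `ClassFloorExitTime` (T3),
`BoundaryReductionEps` (T1a-ε).  They are statements ABOUT the objects above, not named facts from
print (hence untagged; the H21 audit lists them as `proved-helper` once the sibling files land their
`_holds` witnesses — all eight are proved, sorry-free, standard axioms, in this filing).  `--supports
stmt-RiemannHypothesis-0274` (route DBN target): RH-free bookkeeping of the column, closes nothing.

Deliberately NOT here: the far-field targets T6/T6′ (`FarFieldLimitAdmissible1D`, a numerical
inequality decided by interval arithmetic — data item D1′ of THEORY-R2 §6), the finite-system
identities T7–T9 of Sketch3, and anything about `H_t` itself (`Literature.NumberTheory.LFunctions.deBruijnH`).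
-/

noncomputable section

-- D-0017: `Summit.<S>.<S>.…` is the designed namespace of a single-problem summit.
set_option linter.dupNamespace false

open scoped Real
open MeasureTheory Set

namespace Summit.RiemannHypothesis.RiemannHypothesis.Theorems.DbnTheory

/-- The biweight bump `φ(v) = (15/16)(1-v²)²` on `[-1,1]`, zero outside; `∫ φ = 1`.
(THEORY-R1 §1; the smearing profile of the 2001 probe.) -/
def biweight (v : ℝ) : ℝ := if |v| ≤ 1 then (15/16) * (1 - v^2)^2 else 0

/-- The descent kernel `P(ξ,η) = 2[(1-η)/(ξ²+(1-η)²) + (1+η)/(ξ²+(1+η)²)]`: `Y` times the downward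
velocity imparted to the top zero at `(0,Y)` by the zero pair at `(ξY, ±ηY)` under the
Csordas–Smith–Varga dynamics `ż_j = 2 Σ_{k≠j} (z_j - z_k)⁻¹`.  (At the corner `(0,1)` Lean's
`0/0 = 0` gives the junk value `P(0,1) = 1`; every statement below excludes or does not read it.) -/
def descentKernel (ξ η : ℝ) : ℝ :=
  2 * ((1 - η) / (ξ^2 + (1 - η)^2) + (1 + η) / (ξ^2 + (1 + η)^2))

/-- The smeared probe kernel `S_{c,κ,u}(ξ,η) = ∫_{-1}^{1} φ(v)[(c-η)/((c-η)²+(ξ-u-κv)²) +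
(c+η)/((c+η)²+(ξ-u-κv)²)] dv`: `Y` times the pair's contribution to the biweight-smeared zero
detector read at height `cY`, half-width `κY`, offset `uY` (THEORY-R1 §1). -/
def probeKernel (c κ u ξ η : ℝ) : ℝ :=
  ∫ v in (-1:ℝ)..1, biweight v *
    ((c - η) / ((c - η)^2 + (ξ - u - κ * v)^2) + (c + η) / ((c + η)^2 + (ξ - u - κ * v)^2))

/-- A signed multi-probe kernel `k = Σᵢ wᵢ S_{cᵢ,κᵢ,uᵢ}` (weights of either sign). -/
def signedKernel {n : ℕ} (w c κ u : Fin n → ℝ) (ξ η : ℝ) : ℝ :=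
  ∑ i, w i * probeKernel (c i) (κ i) (u i) ξ η

/-- 2-D admissibility = hypothesis (K) of the 2001 descent lemma, for signed kernels:
`k ≤ P` on `ℝ × [0,1] ∖ {(0,1)}`. -/
def Admissible2D {n : ℕ} (w c κ u : Fin n → ℝ) : Prop :=
  ∀ ξ η : ℝ, 0 ≤ η → η ≤ 1 → (ξ, η) ≠ (0, 1) → signedKernel w c κ u ξ η ≤ descentKernel ξ η

/-- 1-D (boundary `η = 1`) admissibility: `k(ξ,1) ≤ P(ξ,1) = 4/(ξ²+4)` for every `ξ`. -/
def Admissible1D {n : ℕ} (w c κ u : Fin n → ℝ) : Prop :=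
  ∀ ξ : ℝ, signedKernel w c κ u ξ 1 ≤ 4 / (ξ^2 + 4)

/-- TARGET T1a (RH-FREE) — boundary reduction: for probes above the top zero (`1 < cᵢ`) and
non-negative smears, (K) on `ℝ × [0,1] ∖ {(0,1)}` is equivalent to the one-dimensional inequality
on the line `η = 1` (maximum principle on the strip `|η| < 1` for the harmonic function `P - k`;
THEORY-R1 §2, proof route THEORY-R3 §6).  Verbatim `DbnTheory.BoundaryReduction` of Sketch.lean. -/
def BoundaryReduction : Prop :=
  ∀ (n : ℕ) (w c κ u : Fin n → ℝ), (∀ i, 1 < c i) → (∀ i, 0 ≤ κ i) →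
    (Admissible1D w c κ u ↔ Admissible2D w c κ u)

/-- TARGET T1b (RH-FREE) — mass of one smeared probe kernel on the boundary line:
`∫_ℝ S_{c,κ,u}(ξ,1) dξ = 2π` (`c > 1`, `κ ≥ 0`).  Verbatim `DbnTheory.ProbeMass`. -/
def ProbeMass : Prop :=
  ∀ c κ u : ℝ, 1 < c → 0 ≤ κ → ∫ ξ, probeKernel c κ u ξ 1 = 2 * π

/-- Mass of the descent kernel on the boundary line: `∫_ℝ 4/(ξ²+4) dξ = 2π`.
Verbatim `DbnTheory.DescentMass`. -/
def DescentMass : Prop := ∫ ξ, (4:ℝ) / (ξ^2 + 4) = 2 * π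

/-- TARGET T1c (RH-FREE) — net-weight ceiling: a 1-D admissible signed kernel has
`W = Σ wᵢ ≤ 1` (integrate `k(·,1) ≤ 4/(ξ²+4)` using T1b and `DescentMass`).
Verbatim `DbnTheory.NetWeightCeiling`. -/
def NetWeightCeiling : Prop :=
  ∀ (n : ℕ) (w c κ u : Fin n → ℝ), (∀ i, 1 < c i) → (∀ i, 0 ≤ κ i) →
    Admissible1D w c κ u → ∑ i, w i ≤ 1

/-- TARGET N1 (RH-FREE) — double-row invisibility (continuum form): the four Poisson-kernel masses
behind the probe-class ceiling of THEORY-R1 §3 (a detector at height `ys > Y` receives total mass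
`2π` from a pair at heights `±Y`, the same as from two real zeros; the pull on a zero at height `Y`
is `4Y/(u²+4Y²)` per pair, mass `2π`, against `2·2Y/(u²+Y²)`, mass `4π`, for two real zeros).
Verbatim `DbnTheory.DoubleRowInvisibility`. -/
def DoubleRowInvisibility : Prop :=
  ∀ ys Y : ℝ, 0 < Y → Y < ys →
    (∫ u, ((ys - Y) / (u^2 + (ys - Y)^2) + (ys + Y) / (u^2 + (ys + Y)^2)) = 2 * π) ∧
    (∫ u, ys / (u^2 + ys^2) = π) ∧
    (∫ u, (4 * Y) / (u^2 + (2 * Y)^2) = 2 * π) ∧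
    (∫ u, (2:ℝ) * ((2 * Y) / (u^2 + Y^2)) = 4 * π)

/-- The idealised class floor: with descent rate `1/Y + ℓ/4` from `Y₀` the exit time is
`(4/ℓ)(Y₀ - (4/ℓ) log(1 + ℓY₀/4))` (`= 0.1020…` at `ℓ = log(X₁/4π) = 26.8918…`, `Y₀ = 0.98846…`;
a MODEL number of THEORY-R1 §3, not a certificate).  Verbatim `DbnTheory.classFloor`. -/
def classFloor (ℓ Y₀ : ℝ) : ℝ := (4 / ℓ) * (Y₀ - (4 / ℓ) * Real.log (1 + ℓ * Y₀ / 4))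

/-- The potential `G(y) = ∫₀^y s/(1 + ℓs/4) ds = (4/ℓ)(y - (4/ℓ) log(1 + ℓy/4))`;
`classFloor ℓ Y₀ = classPotential ℓ Y₀` by `rfl`.  Verbatim `DbnTheory2.classPotential`. -/
def classPotential (ℓ y : ℝ) : ℝ := (4 / ℓ) * (y - (4 / ℓ) * Real.log (1 + ℓ * y / 4))

/-- `classFloor` and `classPotential` are the same function (definitional). -/
theorem classFloor_eq_classPotential (ℓ Y₀ : ℝ) : classFloor ℓ Y₀ = classPotential ℓ Y₀ := rfl

/-- TARGET T3s (RH-FREE, support) — `G'(y) = y/(1 + ℓy/4)` for `ℓ > 0`, `y ≥ 0`.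
Verbatim `DbnTheory2.ClassPotentialDeriv`. -/
def ClassPotentialDeriv : Prop :=
  ∀ ℓ y : ℝ, 0 < ℓ → 0 ≤ y → HasDerivAt (classPotential ℓ) (y / (1 + ℓ * y / 4)) y

/-- TARGET T3 (RH-FREE) — class-floor exit time (ODE comparison): an envelope `Y` that starts at
`Y₀ > 0`, stays positive on `[0,T)`, is continuous on `[0,T]`, vanishes at `T`, and whose
derivative on `(0,T)` is never below the idealised class rate `-(1/Y + ℓ/4)`, cannot reach `0`
before `classFloor ℓ Y₀` (THEORY-R2 §5; `d/dt G(Y t) ≥ -1`).  Verbatim `DbnTheory2.ClassFloorExitTime`. -/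
def ClassFloorExitTime : Prop :=
  ∀ (ℓ Y₀ T : ℝ) (Y : ℝ → ℝ), 0 < ℓ → 0 < Y₀ → 0 < T →
    ContinuousOn Y (Icc 0 T) → Y 0 = Y₀ → Y T = 0 →
    (∀ t ∈ Ico 0 T, 0 < Y t) →
    (∀ t ∈ Ioo 0 T, ∃ d : ℝ, HasDerivAt Y d t ∧ -(1 / Y t + ℓ / 4) ≤ d) →
    classFloor ℓ Y₀ ≤ T

/-- The ε-regularised descent kernel: the poles of `P` moved from `(0,±1)` to `(0,±(1+ε))`;
smooth and harmonic on a neighbourhood of the closed strip `|η| ≤ 1`, `P_0 = P`, and `P_ε → P`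
pointwise as `ε → 0` (THEORY-R3 §6).  Verbatim `DbnTheory3.descentKernelEps`. -/
def descentKernelEps (ε ξ η : ℝ) : ℝ :=
  2 * ((1 + ε - η) / (ξ^2 + (1 + ε - η)^2) + (1 + ε + η) / (ξ^2 + (1 + ε + η)^2))

/-- TARGET T1a-ε (RH-FREE) — ε-regularised boundary reduction: if the signed kernel is dominated
on the two boundary lines `η = ±1` by `P_ε(·,±1) + δ`, it is dominated by `P_ε + δ` on the whole
closed strip (Phragmén–Lindelöf on the strip applied to `exp(K - Π_ε - δ)`, `Re K = k`,
`Re Π_ε = P_ε`; THEORY-R3 §6).  Verbatim `DbnTheory3.BoundaryReductionEps`. -/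
def BoundaryReductionEps : Prop :=
  ∀ (n : ℕ) (w c κ u : Fin n → ℝ) (ε δ : ℝ), (∀ i, 1 < c i) → (∀ i, 0 ≤ κ i) → 0 < ε →
    (∀ ξ : ℝ, signedKernel w c κ u ξ 1 ≤ descentKernelEps ε ξ 1 + δ) →
    (∀ ξ : ℝ, signedKernel w c κ u ξ (-1) ≤ descentKernelEps ε ξ (-1) + δ) →
      ∀ ξ η : ℝ, -1 ≤ η → η ≤ 1 → signedKernel w c κ u ξ η ≤ descentKernelEps ε ξ η + δ

end Summit.RiemannHypothesis.RiemannHypothesis.Theorems.DbnTheory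

end
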